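import Summits.ResolutionOfSingularities.ResolutionOfSingularities.Theorems.PurelyInseparableDim4WideNonTangent
import Summits.ResolutionOfSingularities.ResolutionOfSingularities.Theorems.PurelyInseparableDim4WideRise
import Summits.ResolutionOfSingularities.ResolutionOfSingularities.Theorems.PurelyInseparableDim4DirectrixTwo
import Summits.ResolutionOfSingularities.ResolutionOfSingularities.Theorems.PurelyInseparableDim4ScopeCover
import HarnessLib

/-!
# The NT-RISE specimen is a certified NON-TANGENT edge: (NT)(ii) fires on it while μ⁺ rises

[OURS · census certificate · counted 0.]  Census cell «res-dim4-pi» (D-0157 DOOR 2), desk WORD #59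
(p-4's brick).  crit-1's V-A-27 specimen (p = 3, wide isolated floor state, idea-3's I-3-11 language):
`P = 2xy² + 2xyuv + 2v⁵ + 2x²u³ + 2x²y²v³ →(u-chart, origin)→ C = 2xy² + 2xyuv + 2u²v⁵ + 2x²u² +
2x²y²u⁴v³`, on which res-dim4-p-7 g2 certified `μ⁺ = jetColength` RISES `6 → 7` (`WideRise`,
levels 3 / 5) — «μ⁺ carries no monotonicity into the wide core».  Here the same edge is shown to be an
INSTANCE of res-dim4-p-3 g2's frame theorem (NT)(ii)
`RidgeBudget.jetColength_step_lt_triangle_of_eval_ne_zero` (p665399): the explicit relation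
**`g = 2·D^{(2,0,0,0)}P = u³ + y²v³ ∈ J₃⁺(P)`** (second Hasse `x`-derivative; all monomials of degree
`≥ 3 = o`, the fat-point order of `Z_P = K[u,v]/(u,v)³`) has degree-3 part `u³`, which does NOT vanish
at the direction `e_u` of the move — the move is NON-TANGENT in (NT)'s decidable sense — so (NT)(ii)
gives `d₃(C) = jetColength 3 3 C < 6 = 3·4/2`: the successor's order letter is `≤ 2` (crit-1: o 3 → 2),
WHILE `μ⁺` rises (`jetColength 3 3 P = 6 < 7 = jetColength 3 5 C`, p-7 g2).  Variables
`(x, y, u, v) = Fin 4`, field `𝔽₃`.  Everything specimen-side is by `decide` on res-dim4-p-13's `StepKit`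
term lists (`ScopeCover.hasseDeriv_evalT`); the theorem-side letters are p-7 g2's (`WideRise.*`) and
p-3/p-5/p-12 g2's.  Nothing here proves or disproves resolution of singularities in dim ≥ 4 / char p.
-/

-- house layout `Summits/<Summit>/<Problem>` doubles the namespace component (as in the Target file)
set_option linter.dupNamespace false

noncomputable section

namespace Summit.ResolutionOfSingularities.ResolutionOfSingularities.Theorems.PIDim4

namespace WideNTRiseSpecimen

open MvPolynomial StepKit WideRise
open Literature.AlgebraicGeometry.Resolution

/-- the multi-index `(2,0,0,0)` of the second Hasse `x`-derivative. [folklore] -/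
def α : Fin 4 →₀ ℕ := expo ![2, 0, 0, 0]

/-- `|α| = 2`. [folklore] -/
theorem degree_α : α.degree = 2 := by rw [α, degree_expo]; decide

/-- the exponent of `u³`. [folklore] -/
def eu : Fin 4 →₀ ℕ := expo ![0, 0, 3, 0]
/-- the exponent of `y²v³`. [folklore] -/
def eyv : Fin 4 →₀ ℕ := expo ![0, 2, 0, 3]

/-- `deg u³ = 3`. [folklore] -/
theorem degree_eu : eu.degree = 3 := by rw [eu, degree_expo]; decide
/-- `deg y²v³ = 5`. [folklore] -/
theorem degree_eyv : eyv.degree = 5 := by rw [eyv, degree_expo]; decide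

/-- **`D^{(2,0,0,0)} P = 2u³ + 2y²v³`** (term-list computation). [folklore] -/
theorem hasseDeriv_parent : hasseDeriv α sP.toState.F = monomial eu 2 + monomial eyv 2 := by
  have hL : ScopeCover.hasseL ![2, 0, 0, 0] WideRise.LP =
      [(![0, 0, 0, 5], 0), (![0, 1, 1, 1], 0), (![0, 2, 0, 0], 0), (![0, 0, 3, 0], 2), (![0, 2, 0, 3], 2)] := by
    decide
  rw [SData.toState_F, show sP.L = WideRise.LP from rfl, α, ScopeCover.hasseDeriv_evalT, hL]
  simp only [evalT_cons, evalT_nil, map_zero, zero_add, add_zero]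
  rfl

/-- the relation `g = 2·D^{(2,0,0,0)}P`. [folklore] -/
def g : MvPolynomial (Fin 4) (ZMod 3) := C 2 * hasseDeriv α sP.toState.F

/-- **`g = u³ + y²v³`.** [folklore] -/
theorem g_eq : g = monomial eu 1 + monomial eyv 1 := by
  rw [g, hasseDeriv_parent, mul_add, C_mul_monomial, C_mul_monomial]
  rfl

/-- `g ∈ J₃⁺(P)` (a multiple of a Hasse derivative of order `2 < 3`). [folklore] -/
theorem g_mem_singLocusIdeal : g ∈ singLocusIdeal 3 sP.toState.F :=
  Ideal.mul_mem_left _ _ (Ideal.subset_span ⟨α, by rw [degree_α]; decide, by rw [degree_α]; decide, rfl⟩)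

/-- hence `g ∈ J₃⁺(P) + 𝔪₀⁴`. [folklore] -/
theorem g_mem_sup : g ∈ singLocusIdeal 3 sP.toState.F ⊔ originIdeal (ZMod 3) ^ 4 :=
  Ideal.mem_sup_left g_mem_singLocusIdeal

/-- every monomial of `g` has degree `≥ 3`. [folklore] -/
theorem degree_ge_of_mem_support {A : Fin 4 →₀ ℕ} (hA : A ∈ g.support) : 3 ≤ A.degree := by
  classical
  rw [g_eq] at hA
  rcases Finset.mem_union.mp (support_add hA) with h | h
  · rw [support_monomial, if_neg one_ne_zero, Finset.mem_singleton] at h; rw [h, degree_eu]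
  · rw [support_monomial, if_neg one_ne_zero, Finset.mem_singleton] at h; rw [h, degree_eyv]; decide

/-- the degree-3 part of `g` is `u³`. [folklore] -/
theorem homogeneousComponent_g : homogeneousComponent 3 g = monomial eu 1 := by
  rw [g_eq, map_add, homogeneousComponent_of_mem (isHomogeneous_monomial (1 : ZMod 3) degree_eu),
    homogeneousComponent_of_mem (isHomogeneous_monomial (1 : ZMod 3) degree_eyv), if_pos rfl, if_neg (by decide),
    add_zero]

/-- **NON-TANGENCY at the direction `e_u`**: `(g)_3(e_u) = 1 ≠ 0`. [folklore] -/
theorem eval_direction_ne_zero :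
    eval (Function.update (0 : Fin 4 → ZMod 3) 2 1) (homogeneousComponent 3 g) ≠ 0 := by
  rw [homogeneousComponent_g, eval_monomial, Finsupp.prod_fintype _ _ (fun i => pow_zero _), Fin.prod_univ_four]
  simp [eu, expo, Function.update]

/-- the move: `u`-chart (`j = 2`), origin, a `3`-fold point of the point blow-up. [folklore] -/
theorem isEquimultiplePoint_parent :
    CentreBlowup.IsEquimultiplePoint 3 Finset.univ 2 (0 : Fin 4 → ZMod 3) sP.toState :=
  (isEquimultiplePoint_iff 3 Finset.univ 2 0 sP).mpr (by decide)

/-- the successor of the move IS p-7 g2's child `C`. [folklore] -/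
theorem step_parent : CentreBlowup.step 3 Finset.univ 2 (0 : Fin 4 → ZMod 3) sP.toState = sC.toState := by
  exact (step_eq_iff 3 Finset.univ 2 (0 : Fin 4 → ZMod 3) sP sC).mpr (by decide)

/-- **(NT)(ii) FIRES on the specimen**: `d_k(C) < k(k+1)/2` for every `k ≥ 3` — the successor's fat-point
order is `≤ 2`. Instance of `RidgeBudget.jetColength_step_lt_triangle_of_eval_ne_zero` (p-3 g2) with
the letters `ordZero_parent`, `isClean_parent` (⇒ `gradSpan ≠ ⊥`, p-12's `Directrix`), `ebar_parent`
(p-7 g2) and the explicit non-tangent relation `g`. [folklore] -/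
theorem jetColength_child_lt_triangle {k : ℕ} (hk : 3 ≤ k) :
    RidgeBudget.jetColength 3 k sC.toState.F < k * (k + 1) / 2 := by
  rw [← step_parent]
  exact RidgeBudget.jetColength_step_lt_triangle_of_eval_ne_zero 3 ordZero_parent
    (Directrix.gradSpan_initialForm_ne_bot_of_isClean 3 ordZero_parent isClean_parent) rfl
    isEquimultiplePoint_parent ebar_parent.le (o := 3) (M := 4) (by decide) (by decide) g_mem_sup
    (fun A hA => degree_ge_of_mem_support hA) eval_direction_ne_zero hk

/-- in particular `d₃(C) < 6`: the order letter drops `3 → ≤ 2` on this edge (crit-1: o 3 → 2). [folklore] -/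
theorem jetColength_three_child_lt : RidgeBudget.jetColength 3 3 sC.toState.F < 6 :=
  jetColength_child_lt_triangle le_rfl

end WideNTRiseSpecimen

open WideNTRiseSpecimen WideRise in
/-- **The NT-RISE specimen ‖ K, both letters at once.**  On crit-1's V-A-27 wide edge `P → C` over `𝔽₃`
(point blow-up, `u`-chart, origin): the move is NON-TANGENT in (NT)'s sense (an explicit relation
`g = u³ + y²v³ ∈ J₃⁺(P)` with `(g)_3(e_u) ≠ 0`), (NT)(ii) fires (`d₃(C) < 6`, order letter `≤ 2`), AND
`μ⁺` rises (`jetColength 3 3 P = 6 < 7 = jetColength 3 5 C`, p-7 g2): the order letter and `μ⁺` move in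
opposite directions on one certified edge.  Census/instrument value only. [folklore] -/
theorem ntRise_specimen :
    Step0 3 sP.toState sC.toState ∧
      (∃ g ∈ singLocusIdeal 3 sP.toState.F, (∀ A ∈ g.support, 3 ≤ A.degree) ∧
        MvPolynomial.eval (Function.update (0 : Fin 4 → ZMod 3) 2 1) (MvPolynomial.homogeneousComponent 3 g) ≠ 0) ∧
      RidgeBudget.jetColength 3 3 sC.toState.F < 6 ∧
      RidgeBudget.jetColength 3 3 sP.toState.F < RidgeBudget.jetColength 3 5 sC.toState.F :=
  ⟨step_PC, ⟨g, g_mem_singLocusIdeal, fun _ hA => degree_ge_of_mem_support hA, eval_direction_ne_zero⟩,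
    jetColength_three_child_lt, by rw [jetColength_parent, jetColength_child]; decide⟩

end Summit.ResolutionOfSingularities.ResolutionOfSingularities.Theorems.PIDim4

end
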